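import Literature.IUT.HodgeTheaters.GlobalFrobenioidsArithmeticCor411GF
import Literature.IUT.HodgeTheaters.GlobalFrobenioidsBaseOnEquivalences
import HarnessLib

/-!
# [IUTchI] Example 5.1 (iii) / Corollary 5.3 (i): the natural map `Isom(¹ℱ^⊛, ²ℱ^⊛) → Isom(Base(¹ℱ^⊛), Base(²ℱ^⊛))`
# EXISTS at the GENUINE arithmetic global Frobenioids — `HasUnder` / `UnderUnique` with every displayed binder of
# the model-level knit DISCHARGED (modulo only the slimness of `π₁(†𝒟^⊛)`; nothing at all over `ℬ(G_F)⁰`)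

S. Mochizuki, *Inter-universal Teichmüller theory I*, kurims manuscript (May 2020), Example 5.1 (iii) p. 125 ("`†ℱ^⊛`
… any category equivalent to `ℱ^⊛(†𝒟^⊚)` … is equipped with a natural Frobenioid structure [cf. [FrdI], Corollary
4.11 …]") and Corollary 5.3 (i) p. 144 l. 1–13 ("the natural map `Isom(¹ℱ^⊛, ²ℱ^⊛) → Isom(Base(¹ℱ^⊛), Base(²ℱ^⊛))`
is bijective") ([IUTchI] Cor 5.3 (i) p.144) [claim: Mochizuki2012, status: disputed] — nothing of the series is
asserted; no side is taken on [IUTchIII] Cor. 3.12.  The mathematics is [FrdI] Cor. 4.11 (ii)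
[cite: MochizukiFrdI2008, Cor. 4.11 p.91] at [FrdI] Ex. 6.3 / Thm. 6.4 [cite: MochizukiFrdI2008, Thm. 6.4 (i) p.114].

PROOF-ONLY knit (cell abc-iut; seat abc-iut-w4-d109; row «C53i/M2a», closing the M2 ∘ M2a chain of the L5 hub for
`IUTchI:Cor5.3(i)`), 0 definitions.  abc-iut-L6-t7's `GlobalFrobenioidsBaseOnEquivalences.lean` (row «C53i/M2») turns
[FrdI] Cor. 4.11 (ii)'s `1`-unique squares into abc-iut-L5-t4's binders `CatIsomorphism.HasUnder` / `UnderUnique` for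
the base functors of `ℱ^⊛(†𝒟^⊚)` (`GlobalDivisorData.hasUnder_modelBase`, `underUnique_modelBase`) and of its isomorphs
`†ℱ^⊛` (`GlobalFrobenioid.hasUnder_toBase`, `underUnique_toBase`) under FIVE displayed binders per side —
`ModelFrobenioid.Hypotheses`, `Φ` perf-factorial, `IsSlim (BaseCat G)`, `IsNonDilatingOn Φ`, `¬ IsZeroMonoid Φ`.  At the
GENUINE arithmetic carriers these binders are THEOREMS of `GlobalFrobenioidsArithmeticPullback.lean` (abc-iut-w4-d050:
`arithAlong_hypotheses`) and of abc-iut-w4-d109's `GlobalFrobenioidsArithmeticCor411(.GF).lean`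
(`objectwise_isPerfFactorial_arithAlong`, `isSlim_baseCat_of_isSlimGroup`, `isNonDilatingOn_arithDivisorFunctor_comp`,
`not_isZeroMonoid_arithDivisorFunctor_comp`; at `G = G_F` also `isSlimGroup_absGalGrp`).  Hence:

* §1 over `ℬ(G)⁰`, `G = π₁(†𝒟^⊛) ↠ G_F` (`arithAlong F ρ hρ`): `HasUnder` / `UnderUnique` for the model base functors and
  for the base functors `toBase` of ANY isomorphs `ⁱℱ^⊛` (abc-iut-L5-t1's `GlobalFrobenioid` records), MODULO ONLY
  `IsSlimGroup Gᵢ` (print's standing slimness of `π₁(†𝒟^⊛)`);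
* §2 over `ℬ(G_F)⁰` (`arith F`): the same with NO hypothesis at all.

So abc-iut-L5-t4's natural map `CatIsomorphism.descend` of Cor. 5.3 (i) is DEFINED WITHOUT BINDERS at the genuine
arithmetic carriers; what remains of Cor. 5.3 (i) there is exactly its bijectivity (`DescendBijective`) = the model
case of Ex. 5.1 (v) ([AbsTopIII] Thm. 1.9, FACT-policy) — NOT claimed here.  Nothing here bears on [IUTchIII] Cor. 3.12.
-/

noncomputable section

namespace Literature.IUT.HodgeTheaters

open CategoryTheory Literature.AlgebraicGeometry.Frobenioids Literature.AlgebraicGeometry.Frobenioids.QuasiTemperoid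

universe u

/-! ### §1. Over `†𝒟^⊛ = ℬ(G)⁰`, `G = π₁(†𝒟^⊛) ↠ G_F` -/

namespace GlobalDivisorData

section Along

variable {G₁ : ProfiniteGrp.{0}} (F₁ : Type) [Field F₁] [NumberField F₁] (ρ₁ : G₁ →ₜ* GalFbar F₁)
  (hρ₁ : Function.Surjective ρ₁)
variable {G₂ : ProfiniteGrp.{0}} (F₂ : Type) [Field F₂] [NumberField F₂] (ρ₂ : G₂ →ₜ* GalFbar F₂)
  (hρ₂ : Function.Surjective ρ₂)

/-- **`HasUnder` for the base functors `ℱ^⊛(ⁱ𝒟^⊚) → ℬ(Gᵢ)⁰` at the GENUINE arithmetic models**, modulo only the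
slimness of `G₁, G₂` — abc-iut-L6-t7's `hasUnder_modelBase` with its five binders discharged.
([IUTchI] Cor 5.3 (i) p.144) [claim: Mochizuki2012, status: disputed] -/
theorem hasUnder_modelBase_arithAlong (hZ₁ : IsSlimGroup G₁) (hZ₂ : IsSlimGroup G₂) :
    CatIsomorphism.HasUnder (arithAlong F₁ ρ₁ hρ₁).modelBase (arithAlong F₂ ρ₂ hρ₂).modelBase := by
  haveI : Nonempty (BaseCat G₁) := (isGraphConnected_baseCat G₁).nonempty
  haveI : Nonempty (BaseCat G₂) := (isGraphConnected_baseCat G₂).nonempty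
  exact hasUnder_modelBase _ _ (arithAlong_hypotheses F₁ ρ₁ hρ₁) (arithAlong_hypotheses F₂ ρ₂ hρ₂)
    (objectwise_isPerfFactorial_arithAlong F₁ ρ₁ hρ₁) (objectwise_isPerfFactorial_arithAlong F₂ ρ₂ hρ₂)
    (isSlim_baseCat_of_isSlimGroup G₁ hZ₁) (isSlim_baseCat_of_isSlimGroup G₂ hZ₂)
    (isNonDilatingOn_arithDivisorFunctor_comp (subfieldFunctor F₁ ρ₁ hρ₁))
    (isNonDilatingOn_arithDivisorFunctor_comp (subfieldFunctor F₂ ρ₂ hρ₂))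
    (not_isZeroMonoid_arithDivisorFunctor_comp (subfieldFunctor F₁ ρ₁ hρ₁))
    (not_isZeroMonoid_arithDivisorFunctor_comp (subfieldFunctor F₂ ρ₂ hρ₂))

/-- **`UnderUnique` for the base functors `ℱ^⊛(ⁱ𝒟^⊚) → ℬ(Gᵢ)⁰` at the GENUINE arithmetic models**, modulo only the
slimness of `G₁, G₂`. ([IUTchI] Cor 5.3 (i) p.144) [claim: Mochizuki2012, status: disputed] -/
theorem underUnique_modelBase_arithAlong (hZ₁ : IsSlimGroup G₁) (hZ₂ : IsSlimGroup G₂) :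
    CatIsomorphism.UnderUnique (arithAlong F₁ ρ₁ hρ₁).modelBase (arithAlong F₂ ρ₂ hρ₂).modelBase := by
  haveI : Nonempty (BaseCat G₁) := (isGraphConnected_baseCat G₁).nonempty
  haveI : Nonempty (BaseCat G₂) := (isGraphConnected_baseCat G₂).nonempty
  exact underUnique_modelBase _ _ (arithAlong_hypotheses F₁ ρ₁ hρ₁) (arithAlong_hypotheses F₂ ρ₂ hρ₂)
    (objectwise_isPerfFactorial_arithAlong F₁ ρ₁ hρ₁) (objectwise_isPerfFactorial_arithAlong F₂ ρ₂ hρ₂)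
    (isSlim_baseCat_of_isSlimGroup G₁ hZ₁) (isSlim_baseCat_of_isSlimGroup G₂ hZ₂)
    (isNonDilatingOn_arithDivisorFunctor_comp (subfieldFunctor F₁ ρ₁ hρ₁))
    (isNonDilatingOn_arithDivisorFunctor_comp (subfieldFunctor F₂ ρ₂ hρ₂))
    (not_isZeroMonoid_arithDivisorFunctor_comp (subfieldFunctor F₁ ρ₁ hρ₁))
    (not_isZeroMonoid_arithDivisorFunctor_comp (subfieldFunctor F₂ ρ₂ hρ₂))

end Along

end GlobalDivisorData

namespace GlobalFrobenioid

section Along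

variable {G₁ : ProfiniteGrp.{0}} {F₁ : Type} [Field F₁] [NumberField F₁] {ρ₁ : G₁ →ₜ* GalFbar F₁}
  {hρ₁ : Function.Surjective ρ₁} {Dcirc₁ : Type 1} [Category.{0} Dcirc₁] {toBase0₁ : Dcirc₁ ⥤ BaseCat G₁}
variable {G₂ : ProfiniteGrp.{0}} {F₂ : Type} [Field F₂] [NumberField F₂] {ρ₂ : G₂ →ₜ* GalFbar F₂}
  {hρ₂ : Function.Surjective ρ₂} {Dcirc₂ : Type 1} [Category.{0} Dcirc₂] {toBase0₂ : Dcirc₂ ⥤ BaseCat G₂}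
variable (𝓕₁ : GlobalFrobenioid (GlobalDivisorData.arithAlong F₁ ρ₁ hρ₁) Dcirc₁ toBase0₁)
  (𝓕₂ : GlobalFrobenioid (GlobalDivisorData.arithAlong F₂ ρ₂ hρ₂) Dcirc₂ toBase0₂)

/-- **[IUTchI] Ex. 5.1 (iii) "`†ℱ^⊛` … any category equivalent to `ℱ^⊛(†𝒟^⊚)` … natural Frobenioid structure [cf.
[FrdI] Cor 4.11]" — `HasUnder` for the base functors `ⁱℱ^⊛ → Base(ⁱℱ^⊛)` of ANY two isomorphs of the GENUINE arithmetic
models**, modulo only the slimness of `G₁, G₂`: under every `Ψ : ¹ℱ^⊛ ⥲ ²ℱ^⊛` lies an equivalence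
`Base(¹ℱ^⊛) ⥲ Base(²ℱ^⊛)` (abc-iut-L6-t7's `hasUnder_toBase`, binders discharged).
([IUTchI] Cor 5.3 (i) p.144) [claim: Mochizuki2012, status: disputed] -/
theorem hasUnder_toBase_arithAlong (hZ₁ : IsSlimGroup G₁) (hZ₂ : IsSlimGroup G₂) :
    CatIsomorphism.HasUnder 𝓕₁.toBase 𝓕₂.toBase := by
  haveI : Nonempty (BaseCat G₁) := (isGraphConnected_baseCat G₁).nonempty
  haveI : Nonempty (BaseCat G₂) := (isGraphConnected_baseCat G₂).nonempty
  exact 𝓕₁.hasUnder_toBase 𝓕₂ (GlobalDivisorData.arithAlong_hypotheses F₁ ρ₁ hρ₁)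
    (GlobalDivisorData.arithAlong_hypotheses F₂ ρ₂ hρ₂)
    (GlobalDivisorData.objectwise_isPerfFactorial_arithAlong F₁ ρ₁ hρ₁)
    (GlobalDivisorData.objectwise_isPerfFactorial_arithAlong F₂ ρ₂ hρ₂)
    (isSlim_baseCat_of_isSlimGroup G₁ hZ₁) (isSlim_baseCat_of_isSlimGroup G₂ hZ₂)
    (isNonDilatingOn_arithDivisorFunctor_comp (subfieldFunctor F₁ ρ₁ hρ₁))
    (isNonDilatingOn_arithDivisorFunctor_comp (subfieldFunctor F₂ ρ₂ hρ₂))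
    (not_isZeroMonoid_arithDivisorFunctor_comp (subfieldFunctor F₁ ρ₁ hρ₁))
    (not_isZeroMonoid_arithDivisorFunctor_comp (subfieldFunctor F₂ ρ₂ hρ₂))

/-- **`UnderUnique` for the base functors of ANY two isomorphs `ⁱℱ^⊛` of the genuine arithmetic models**, modulo only
the slimness of `G₁, G₂` — so `CatIsomorphism.descend` (the natural map of Cor. 5.3 (i)) and `descendHom`
(`Aut(ℱ^⊛) → Aut(Base)`) are defined here without further binders.
([IUTchI] Cor 5.3 (i) p.144) [claim: Mochizuki2012, status: disputed] -/
theorem underUnique_toBase_arithAlong (hZ₁ : IsSlimGroup G₁) (hZ₂ : IsSlimGroup G₂) :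
    CatIsomorphism.UnderUnique 𝓕₁.toBase 𝓕₂.toBase := by
  haveI : Nonempty (BaseCat G₁) := (isGraphConnected_baseCat G₁).nonempty
  haveI : Nonempty (BaseCat G₂) := (isGraphConnected_baseCat G₂).nonempty
  exact 𝓕₁.underUnique_toBase 𝓕₂ (GlobalDivisorData.arithAlong_hypotheses F₁ ρ₁ hρ₁)
    (GlobalDivisorData.arithAlong_hypotheses F₂ ρ₂ hρ₂)
    (GlobalDivisorData.objectwise_isPerfFactorial_arithAlong F₁ ρ₁ hρ₁)
    (GlobalDivisorData.objectwise_isPerfFactorial_arithAlong F₂ ρ₂ hρ₂)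
    (isSlim_baseCat_of_isSlimGroup G₁ hZ₁) (isSlim_baseCat_of_isSlimGroup G₂ hZ₂)
    (isNonDilatingOn_arithDivisorFunctor_comp (subfieldFunctor F₁ ρ₁ hρ₁))
    (isNonDilatingOn_arithDivisorFunctor_comp (subfieldFunctor F₂ ρ₂ hρ₂))
    (not_isZeroMonoid_arithDivisorFunctor_comp (subfieldFunctor F₁ ρ₁ hρ₁))
    (not_isZeroMonoid_arithDivisorFunctor_comp (subfieldFunctor F₂ ρ₂ hρ₂))

end Along

end GlobalFrobenioid

/-! ### §2. Over `†𝒟^⊛ = ℬ(G_F)⁰` (`arith`), hypothesis-free -/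

namespace GlobalDivisorData

section Arith

variable (F₁ : Type) [Field F₁] [NumberField F₁] (F₂ : Type) [Field F₂] [NumberField F₂]

/-- **`HasUnder` for `ℱ^⊛(†𝒟^⊚) → ℬ(G_{Fᵢ})⁰` with NO hypothesis** (`G_F` slim: `galoisNF_slim_holds`).
([IUTchI] Cor 5.3 (i) p.144) [claim: Mochizuki2012, status: disputed] -/
theorem hasUnder_modelBase_arith : CatIsomorphism.HasUnder (arith F₁).modelBase (arith F₂).modelBase := by
  haveI : Nonempty (BaseCat (absGalGrp F₁)) := (isGraphConnected_baseCat (absGalGrp F₁)).nonempty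
  haveI : Nonempty (BaseCat (absGalGrp F₂)) := (isGraphConnected_baseCat (absGalGrp F₂)).nonempty
  exact hasUnder_modelBase _ _ (arith_hypotheses F₁) (arith_hypotheses F₂)
    (objectwise_isPerfFactorial_arith F₁) (objectwise_isPerfFactorial_arith F₂)
    (isSlim_baseCat_absGalGrp F₁) (isSlim_baseCat_absGalGrp F₂)
    (isNonDilatingOn_arithDivisorFunctor_comp (galoisSubextOfFinite F₁))
    (isNonDilatingOn_arithDivisorFunctor_comp (galoisSubextOfFinite F₂))
    (not_isZeroMonoid_arithDivisorFunctor_comp (galoisSubextOfFinite F₁))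
    (not_isZeroMonoid_arithDivisorFunctor_comp (galoisSubextOfFinite F₂))

/-- **`UnderUnique` for `ℱ^⊛(†𝒟^⊚) → ℬ(G_{Fᵢ})⁰` with NO hypothesis.**
([IUTchI] Cor 5.3 (i) p.144) [claim: Mochizuki2012, status: disputed] -/
theorem underUnique_modelBase_arith : CatIsomorphism.UnderUnique (arith F₁).modelBase (arith F₂).modelBase := by
  haveI : Nonempty (BaseCat (absGalGrp F₁)) := (isGraphConnected_baseCat (absGalGrp F₁)).nonempty
  haveI : Nonempty (BaseCat (absGalGrp F₂)) := (isGraphConnected_baseCat (absGalGrp F₂)).nonempty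
  exact underUnique_modelBase _ _ (arith_hypotheses F₁) (arith_hypotheses F₂)
    (objectwise_isPerfFactorial_arith F₁) (objectwise_isPerfFactorial_arith F₂)
    (isSlim_baseCat_absGalGrp F₁) (isSlim_baseCat_absGalGrp F₂)
    (isNonDilatingOn_arithDivisorFunctor_comp (galoisSubextOfFinite F₁))
    (isNonDilatingOn_arithDivisorFunctor_comp (galoisSubextOfFinite F₂))
    (not_isZeroMonoid_arithDivisorFunctor_comp (galoisSubextOfFinite F₁))
    (not_isZeroMonoid_arithDivisorFunctor_comp (galoisSubextOfFinite F₂))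

end Arith

end GlobalDivisorData

namespace GlobalFrobenioid

section Arith

variable {F₁ : Type} [Field F₁] [NumberField F₁] {Dcirc₁ : Type 1} [Category.{0} Dcirc₁]
  {toBase0₁ : Dcirc₁ ⥤ BaseCat (absGalGrp F₁)}
variable {F₂ : Type} [Field F₂] [NumberField F₂] {Dcirc₂ : Type 1} [Category.{0} Dcirc₂]
  {toBase0₂ : Dcirc₂ ⥤ BaseCat (absGalGrp F₂)}
variable (𝓕₁ : GlobalFrobenioid (GlobalDivisorData.arith F₁) Dcirc₁ toBase0₁)
  (𝓕₂ : GlobalFrobenioid (GlobalDivisorData.arith F₂) Dcirc₂ toBase0₂)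

/-- **[IUTchI] Ex. 5.1 (iii) / Cor. 5.3 (i) for ANY two isomorphs `ⁱℱ^⊛` of the genuine arithmetic models over
`ℬ(G_{Fᵢ})⁰`, with NO hypothesis**: `HasUnder` for their base functors — the natural map
`Isom(¹ℱ^⊛, ²ℱ^⊛) → Isom(Base(¹ℱ^⊛), Base(²ℱ^⊛))` EXISTS. ([IUTchI] Cor 5.3 (i) p.144) [claim: Mochizuki2012, status: disputed] -/
theorem hasUnder_toBase_arith : CatIsomorphism.HasUnder 𝓕₁.toBase 𝓕₂.toBase := by
  haveI : Nonempty (BaseCat (absGalGrp F₁)) := (isGraphConnected_baseCat (absGalGrp F₁)).nonempty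
  haveI : Nonempty (BaseCat (absGalGrp F₂)) := (isGraphConnected_baseCat (absGalGrp F₂)).nonempty
  exact 𝓕₁.hasUnder_toBase 𝓕₂ (GlobalDivisorData.arith_hypotheses F₁) (GlobalDivisorData.arith_hypotheses F₂)
    (GlobalDivisorData.objectwise_isPerfFactorial_arith F₁) (GlobalDivisorData.objectwise_isPerfFactorial_arith F₂)
    (isSlim_baseCat_absGalGrp F₁) (isSlim_baseCat_absGalGrp F₂)
    (isNonDilatingOn_arithDivisorFunctor_comp (galoisSubextOfFinite F₁))
    (isNonDilatingOn_arithDivisorFunctor_comp (galoisSubextOfFinite F₂))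
    (not_isZeroMonoid_arithDivisorFunctor_comp (galoisSubextOfFinite F₁))
    (not_isZeroMonoid_arithDivisorFunctor_comp (galoisSubextOfFinite F₂))

/-- **… and `UnderUnique`, with NO hypothesis** — so `CatIsomorphism.descend` / `descendHom` for isomorphs of the
arithmetic `ℱ^⊛(†𝒟^⊚)` are defined without binders. ([IUTchI] Cor 5.3 (i) p.144) [claim: Mochizuki2012, status: disputed] -/
theorem underUnique_toBase_arith : CatIsomorphism.UnderUnique 𝓕₁.toBase 𝓕₂.toBase := by
  haveI : Nonempty (BaseCat (absGalGrp F₁)) := (isGraphConnected_baseCat (absGalGrp F₁)).nonempty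
  haveI : Nonempty (BaseCat (absGalGrp F₂)) := (isGraphConnected_baseCat (absGalGrp F₂)).nonempty
  exact 𝓕₁.underUnique_toBase 𝓕₂ (GlobalDivisorData.arith_hypotheses F₁) (GlobalDivisorData.arith_hypotheses F₂)
    (GlobalDivisorData.objectwise_isPerfFactorial_arith F₁) (GlobalDivisorData.objectwise_isPerfFactorial_arith F₂)
    (isSlim_baseCat_absGalGrp F₁) (isSlim_baseCat_absGalGrp F₂)
    (isNonDilatingOn_arithDivisorFunctor_comp (galoisSubextOfFinite F₁))
    (isNonDilatingOn_arithDivisorFunctor_comp (galoisSubextOfFinite F₂))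
    (not_isZeroMonoid_arithDivisorFunctor_comp (galoisSubextOfFinite F₁))
    (not_isZeroMonoid_arithDivisorFunctor_comp (galoisSubextOfFinite F₂))

end Arith

end GlobalFrobenioid

end Literature.IUT.HodgeTheaters

end
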